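import Summits.ResolutionOfSingularities.ResolutionOfSingularities.Theorems.FrobeniusClosingPatchingRelPerfectDepthDirectionMapCohen
import Summits.ResolutionOfSingularities.ResolutionOfSingularities.Theorems.FrobeniusClosingPatchingRelPerfectDepthDirectionMapLaurent
import Literature.AlgebraicGeometry.Resolution.SmoothFactorizationsBaseInduction
import HarnessLib

/-!
# Crux `PatchingRelPerfect` (stmt-ResolutionOfSingularities-16161), chain W5.2 — F7(β) (β-AX) T0 `InitialMultiHost₂`,
# piece (B-alg) ASSEMBLY: the DIRECTION MAP `κ₀[u] → S_𝔭`, `uᵢ ↦ x_{j⁺(i)} / x_j`, of a complete regular local ring with a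
# coefficient field is a regular homomorphism — flat, with regular closed fibre

[OURS · L1 W5.2 · rung tool; res-L1-w52-plan-1 RULING G11-27 (2) → res-D-pv-046 (B-alg `DepthMultiHost.DirectionMapRegular`)]
Replaces the role of NO printed item of the manuscript under review; fact-free; any dimension, any characteristic.

Let `(S, 𝔪)` be complete regular local of dimension `n + 1` with coefficient field `σ : κ₀ → S` and regular system of
parameters `x₀, …, x_n`; let `𝔭` be a prime of `S` with `x_j ∉ 𝔭`, so `x_j` is a unit of `B = S_𝔭`. The direction map is
the ring map `ψ : U = κ₀[u₁, …, u_n] → B` with `ψ(c) = σ(c)` and `ψ(uᵢ) · x_j = x_{j.succAbove i}` (these two identities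
characterise it; res-D-pv-055΄s `MvPolynomial.eval₂Hom σ (xᵢ'/x_j)` satisfies them). Then:

* `isRegularHom_directionMap` — `ψ` is a REGULAR HOMOMORPHISM: `ψ = λ ∘ θ` with `θ : U → κ₀[X][X_j⁻¹]` the direction chart
  (`isRegularHom_directionChart`, Laurent file) and `λ : κ₀[X][X_j⁻¹] → S_𝔭` the localisation of the Cohen coordinate map
  (`isRegularHom_cohenCoordinates`, Cohen file; `comp_isLocalization_right`, `of_isLocalization_left`); `IsRegularHom.comp`.
* `isRegularHom_directionMap_localization` — hence `U_𝔮 → S_𝔭` (`𝔮 = ψ⁻¹(𝔭 S_𝔭)`) is a regular homomorphism for any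
  compatible algebra structure (`of_isLocalization_left`); in particular FLAT (`flat_directionMap_localization`).
* `isRegularLocalRing_directionMap_closedFibre` — the closed fibre `S_𝔭 ⧸ 𝔮 S_𝔭` is a REGULAR local ring
  (`IsRegularHom.quotient`, then over the fraction field of `U ⧸ 𝔮` by `of_isLocalization_left`, `IsRegularHom.isRegularRing`
  from the regular ring `Frac(U/𝔮)`, and a local regular ring is a regular local ring).

## References (for the mathematics; nothing here is a statement of the manuscript under review)
* H. Matsumura, *Commutative Ring Theory* (1986), Thm. 23.7, Thm. 29.7, §32 p. 256. [Matsumura1987]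
-/

-- `Summit.<Summit>.<Sub>.Theorems` with `Sub = Summit` (single-conjunct summit, D-0017)
set_option linter.dupNamespace false

noncomputable section

open IsLocalRing Literature.AlgebraicGeometry.Resolution

namespace Summit.ResolutionOfSingularities.ResolutionOfSingularities.Theorems

universe u

namespace DepthMultiHost

variable {κ₀ : Type u} [Field κ₀] {S : Type u} [CommRing S] [IsRegularLocalRing S] [IsAdicComplete (maximalIdeal S) S]
  (σ : κ₀ →+* S) (hσ : Function.Bijective ((residue S).comp σ)) {n : ℕ} (x : Fin (n + 1) → S)
  (hx : Ideal.span (Set.range x) = maximalIdeal S) (hd : ringKrullDim S = (n + 1 : ℕ))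
  (𝔭 : Ideal S) [𝔭.IsPrime] (j : Fin (n + 1)) (hj : x j ∉ 𝔭)
  (ψ : MvPolynomial (Fin n) κ₀ →+* Localization.AtPrime 𝔭)
  (hψC : ∀ c, ψ (MvPolynomial.C c) = algebraMap S (Localization.AtPrime 𝔭) (σ c))
  (hψX : ∀ i, ψ (MvPolynomial.X i) * algebraMap S (Localization.AtPrime 𝔭) (x j) =
    algebraMap S (Localization.AtPrime 𝔭) (x (j.succAbove i)))

include hσ hx hd hj hψC hψX in
/-- **The direction map is a regular homomorphism.** [cite: Matsumura1987, Thm. 29.7 with §32 p. 256] -/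
theorem isRegularHom_directionMap :
    letI := ψ.toAlgebra
    IsRegularHom (MvPolynomial (Fin n) κ₀) (Localization.AtPrime 𝔭) := by
  classical
  -- names and algebra structures
  let U := MvPolynomial (Fin n) κ₀
  let R := MvPolynomial (Fin (n + 1)) κ₀
  let B := Localization.AtPrime 𝔭
  let R' := Localization.Away (MvPolynomial.X j : R)
  letI algUB : Algebra U B := ψ.toAlgebra
  change IsRegularHom U B
  letI algRS : Algebra R S := (MvPolynomial.eval₂Hom σ x).toAlgebra
  -- (1) `R → S → B` is regular (Cohen file + localisation of the target)
  have hRS : IsRegularHom R S := isRegularHom_cohenCoordinates σ hσ x hx hd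
  have hRB : IsRegularHom R B := hRS.comp_isLocalization_right 𝔭.primeCompl B
  -- (2) through `R' = R[X_j⁻¹]`: `x_j` is a unit of `B`
  have hRBX : ∀ k, algebraMap R B (MvPolynomial.X k) = algebraMap S B (x k) := fun k => by
    rw [IsScalarTower.algebraMap_apply R S B]
    change algebraMap S B (MvPolynomial.eval₂Hom σ x (MvPolynomial.X k)) = _
    rw [MvPolynomial.eval₂Hom_X']
  have hRBC : ∀ c, algebraMap R B (MvPolynomial.C c) = algebraMap S B (σ c) := fun c => by
    rw [IsScalarTower.algebraMap_apply R S B]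
    change algebraMap S B (MvPolynomial.eval₂Hom σ x (MvPolynomial.C c)) = _
    rw [MvPolynomial.eval₂Hom_C]
  have hunit : IsUnit (algebraMap R B (MvPolynomial.X j)) := by
    rw [hRBX]
    exact IsLocalization.map_units B (⟨x j, hj⟩ : 𝔭.primeCompl)
  let lam : R' →+* B := IsLocalization.Away.lift (MvPolynomial.X j : R) (g := algebraMap R B) hunit
  have hlam : ∀ r : R, lam (algebraMap R R' r) = algebraMap R B r := fun r => IsLocalization.Away.lift_eq _ _ _
  letI algR'B : Algebra R' B := lam.toAlgebra
  haveI : IsScalarTower R R' B := IsScalarTower.of_algebraMap_eq fun r => (hlam r).symm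
  have hR'B : IsRegularHom R' B := hRB.of_isLocalization_left (Submonoid.powers (MvPolynomial.X j : R)) R' B
  -- (3) the direction chart `θ : U → R'` (Laurent file) and `ψ = λ ∘ θ`
  let θ : U →+* R' := MvPolynomial.eval₂Hom (algebraMap κ₀ R')
    (fun i => algebraMap R R' (MvPolynomial.X (j.succAbove i)) * IsLocalization.Away.invSelf (MvPolynomial.X j : R))
  letI algUR' : Algebra U R' := θ.toAlgebra
  have hUR' : IsRegularHom U R' := isRegularHom_directionChart κ₀ n j
  have hlaminv : lam (IsLocalization.Away.invSelf (MvPolynomial.X j : R)) * algebraMap R B (MvPolynomial.X j) = 1 := by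
    rw [← hlam, ← map_mul, mul_comm, IsLocalization.Away.mul_invSelf, map_one]
  have hψ : ψ = lam.comp θ := by
    refine MvPolynomial.ringHom_ext (fun c => ?_) (fun i => ?_)
    · rw [hψC, RingHom.comp_apply, MvPolynomial.eval₂Hom_C, IsScalarTower.algebraMap_apply κ₀ R R',
        MvPolynomial.algebraMap_eq, hlam, hRBC]
    · refine (hunit.mul_left_inj).mp ?_
      rw [hRBX j, hψX, RingHom.comp_apply, MvPolynomial.eval₂Hom_X', map_mul, hlam, ← hRBX j, mul_assoc, hlaminv,
        mul_one, hRBX]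
  haveI : IsScalarTower U R' B := IsScalarTower.of_algebraMap_eq fun v => by
    change ψ v = lam (θ v)
    rw [hψ, RingHom.comp_apply]
  -- (4) compose
  haveI : IsNoetherianRing R' :=
    IsLocalization.isNoetherianRing (Submonoid.powers (MvPolynomial.X j : R)) R' inferInstance
  exact hUR'.comp hR'B

include hσ hx hd hj hψC hψX in
/-- **The localised direction map `U_𝔮 → S_𝔭`, `𝔮 = ψ⁻¹(𝔭 S_𝔭)`, is a regular homomorphism** — for ANY algebra structure
`U_𝔮 → S_𝔭` compatible with `ψ` (e.g. `Localization.localRingHom`, `IsLocalization.lift`). [cite: Matsumura1987, §32 p. 256] -/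
theorem isRegularHom_directionMap_localization
    [Algebra (Localization.AtPrime ((maximalIdeal (Localization.AtPrime 𝔭)).comap ψ)) (Localization.AtPrime 𝔭)]
    (htower : ∀ v, algebraMap (Localization.AtPrime ((maximalIdeal (Localization.AtPrime 𝔭)).comap ψ))
      (Localization.AtPrime 𝔭) (algebraMap (MvPolynomial (Fin n) κ₀) _ v) = ψ v) :
    IsRegularHom (Localization.AtPrime ((maximalIdeal (Localization.AtPrime 𝔭)).comap ψ)) (Localization.AtPrime 𝔭) := by
  letI algUB : Algebra (MvPolynomial (Fin n) κ₀) (Localization.AtPrime 𝔭) := ψ.toAlgebra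
  haveI : IsScalarTower (MvPolynomial (Fin n) κ₀)
      (Localization.AtPrime ((maximalIdeal (Localization.AtPrime 𝔭)).comap ψ)) (Localization.AtPrime 𝔭) :=
    IsScalarTower.of_algebraMap_eq fun v => (htower v).symm
  exact (isRegularHom_directionMap σ hσ x hx hd 𝔭 j hj ψ hψC hψX).of_isLocalization_left
    ((maximalIdeal (Localization.AtPrime 𝔭)).comap ψ).primeCompl _ _

include hσ hx hd hj hψC hψX in
/-- **The localised direction map is flat.** [cite: Matsumura1987, §32 p. 256] -/
theorem flat_directionMap_localization
    [Algebra (Localization.AtPrime ((maximalIdeal (Localization.AtPrime 𝔭)).comap ψ)) (Localization.AtPrime 𝔭)]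
    (htower : ∀ v, algebraMap (Localization.AtPrime ((maximalIdeal (Localization.AtPrime 𝔭)).comap ψ))
      (Localization.AtPrime 𝔭) (algebraMap (MvPolynomial (Fin n) κ₀) _ v) = ψ v) :
    Module.Flat (Localization.AtPrime ((maximalIdeal (Localization.AtPrime 𝔭)).comap ψ)) (Localization.AtPrime 𝔭) :=
  (isRegularHom_directionMap_localization σ hσ x hx hd 𝔭 j hj ψ hψC hψX htower).1

/-- **A local ring that is a regular ring is a regular local ring.** [folklore] -/
theorem isRegularLocalRing_of_isRegularRing_of_isLocalRing (A : Type u) [CommRing A] [IsLocalRing A] [IsRegularRing A] :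
    IsRegularLocalRing A := by
  haveI : IsRegularLocalRing (Localization.AtPrime (maximalIdeal A)) := inferInstance
  let e : A ≃ₐ[A] Localization.AtPrime (maximalIdeal A) :=
    IsLocalization.atUnits A (maximalIdeal A).primeCompl fun a ha => by
      change IsUnit a
      by_contra hna
      exact ha ((mem_maximalIdeal a).mpr (mem_nonunits_iff.mpr hna))
  exact IsRegularLocalRing.of_ringEquiv e.symm.toRingEquiv

/-- **The closed fibre of a local regular homomorphism out of a ring essentially of finite type… — generic form used
here: if `ψ : U → B` is a regular homomorphism into a Noetherian local ring `B`, then `B ⧸ 𝔮B` (`𝔮 = ψ⁻¹ 𝔪_B`) is a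
regular local ring.** Proof: `U/𝔮 → B/𝔮B` is regular (`IsRegularHom.quotient`); every non-zero element of the domain
`U/𝔮` becomes a unit of the local ring `B/𝔮B`, so `Frac(U/𝔮) → B/𝔮B` is regular (`of_isLocalization_left`), and a regular
homomorphism from a regular ring (a field) has regular target (`IsRegularHom.isRegularRing`, Matsumura 23.7).
[cite: Matsumura1987, Thm. 23.7] -/
theorem isRegularLocalRing_quotient_of_isRegularHom {U B : Type u} [CommRing U] [CommRing B] [IsLocalRing B]
    [IsNoetherianRing B] [Algebra U B] (h : IsRegularHom U B) :
    IsRegularLocalRing (B ⧸ ((maximalIdeal B).comap (algebraMap U B)).map (algebraMap U B)) := by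
  classical
  set 𝔮 := (maximalIdeal B).comap (algebraMap U B) with h𝔮
  haveI : 𝔮.IsPrime := Ideal.comap_isPrime _ _
  have hle : 𝔮.map (algebraMap U B) ≤ maximalIdeal B := Ideal.map_comap_le
  have hne : 𝔮.map (algebraMap U B) ≠ ⊤ := fun htop =>
    (maximalIdeal.isMaximal B).ne_top (top_le_iff.mp (htop ▸ hle))
  haveI : Nontrivial (B ⧸ 𝔮.map (algebraMap U B)) :=
    ⟨⟨0, 1, fun h01 => hne (Ideal.Quotient.zero_eq_one_iff.mp h01)⟩⟩
  haveI : IsLocalRing (B ⧸ 𝔮.map (algebraMap U B)) :=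
    IsLocalRing.of_surjective' (Ideal.Quotient.mk _) Ideal.Quotient.mk_surjective
  -- `U/𝔮 → B/𝔮B` is regular
  have hq : IsRegularHom (U ⧸ 𝔮) (B ⧸ 𝔮.map (algebraMap U B)) := h.quotient 𝔮
  -- every non-zero element of `U/𝔮` is a unit of `B/𝔮B`
  have hunits : ∀ y : nonZeroDivisors (U ⧸ 𝔮), IsUnit (algebraMap (U ⧸ 𝔮) (B ⧸ 𝔮.map (algebraMap U B)) y) := by
    rintro ⟨y, hy⟩
    obtain ⟨v, rfl⟩ := Ideal.Quotient.mk_surjective y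
    have hv : v ∉ 𝔮 := fun hv => by
      have : (Ideal.Quotient.mk 𝔮 v) = 0 := Ideal.Quotient.eq_zero_iff_mem.mpr hv
      exact (nonZeroDivisors.ne_zero hy) this
    have hvB : IsUnit (algebraMap U B v) := by
      by_contra hnu
      exact hv ((mem_maximalIdeal _).mpr (mem_nonunits_iff.mpr hnu))
    change IsUnit (Ideal.Quotient.mk (𝔮.map (algebraMap U B)) (algebraMap U B v))
    exact hvB.map _
  -- so `Frac(U/𝔮) → B/𝔮B` is regular, and `Frac(U/𝔮)` is a regular ring
  let K := FractionRing (U ⧸ 𝔮)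
  let lamK : K →+* B ⧸ 𝔮.map (algebraMap U B) := IsLocalization.lift (M := nonZeroDivisors (U ⧸ 𝔮)) hunits
  letI : Algebra K (B ⧸ 𝔮.map (algebraMap U B)) := lamK.toAlgebra
  haveI : IsScalarTower (U ⧸ 𝔮) K (B ⧸ 𝔮.map (algebraMap U B)) :=
    IsScalarTower.of_algebraMap_eq fun y => (IsLocalization.lift_eq hunits y).symm
  have hK : IsRegularHom K (B ⧸ 𝔮.map (algebraMap U B)) :=
    hq.of_isLocalization_left (nonZeroDivisors (U ⧸ 𝔮)) K _
  haveI : IsRegularRing (B ⧸ 𝔮.map (algebraMap U B)) := hK.isRegularRing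
  exact isRegularLocalRing_of_isRegularRing_of_isLocalRing _

include hσ hx hd hj hψC hψX in
/-- **The closed fibre `S_𝔭 ⧸ 𝔮 S_𝔭` of the direction map is a regular local ring.** [cite: Matsumura1987, Thm. 23.7] -/
theorem isRegularLocalRing_directionMap_closedFibre :
    IsRegularLocalRing (Localization.AtPrime 𝔭 ⧸ ((maximalIdeal (Localization.AtPrime 𝔭)).comap ψ).map ψ) := by
  letI algUB : Algebra (MvPolynomial (Fin n) κ₀) (Localization.AtPrime 𝔭) := ψ.toAlgebra
  exact isRegularLocalRing_quotient_of_isRegularHom (isRegularHom_directionMap σ hσ x hx hd 𝔭 j hj ψ hψC hψX)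

include hσ hx hd hj hψC hψX in
/-- **The direction map: flat, with regular closed fibre** — the conclusion in the exact ring-level shape consumed by
res-D-pv-055΄s (B-plumb) / pv-034΄s kernel `isParamLiftAt_of_flat_of_isRegularLocalRing_fiber` (SIGNATURE line
2026-08-27T17:34:52Z). [cite: Matsumura1987, Thm. 23.7 with §32 p. 256] -/
theorem directionMap_flat_and_isRegularLocalRing_fiber :
    ψ.Flat ∧ IsRegularLocalRing
      (Localization.AtPrime 𝔭 ⧸ Ideal.map ψ ((maximalIdeal (Localization.AtPrime 𝔭)).comap ψ)) := by
  letI algUB : Algebra (MvPolynomial (Fin n) κ₀) (Localization.AtPrime 𝔭) := ψ.toAlgebra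
  have h := isRegularHom_directionMap σ hσ x hx hd 𝔭 j hj ψ hψC hψX
  exact ⟨h.1, isRegularLocalRing_quotient_of_isRegularHom h⟩

end DepthMultiHost

end Summit.ResolutionOfSingularities.ResolutionOfSingularities.Theorems

end
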